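import Summits.ResolutionOfSingularities.ResolutionOfSingularities.Theorems.MarkedTransferCampaignW46ThreefoldsPlumbing
import HarnessLib

/-!
# [OURS · L1 W4.6] STRING READINGS — the termination shapes made GENERIC in which `Inv`-string a résumé carries
# (design points (M) `m := t` and (M⁺) `m := t + 1` of the shared module as two instances): STATEMENT module (definitions)

Cell res-hironaka, LADDER-RESOLUTION rung L (D-0089), slot W4.6; seat res-L1-s46-pv-3 (gen 2). Host route MarkedTransfer,
host item `HypersurfaceOrderReductionDimLeThree` (stmt-16156); `--kind definition --supports` it.

HONEST FRAMING. Everything below is OURS: campaign definitions over the shared vocabulary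
`Theorems/MarkedTransferCampaignW46TypedProcedure.lean` v4 (`Resume`, `Step`, `Regime`, `Resume.invStr` / `Resume.m` = design
point (M), `Resume.invStrSucc` / `Resume.mSucc` = reading sibling (M⁺)). NOTHING here is a statement of H. Hironaka's
manuscript (2017-03-23, [Hironaka2017]) and nothing asserts that any statement of it holds. No theorem beyond `rfl`
unfoldings; the reductions are the companion module `MarkedTransferCampaignW46StringReadingReduction`. AI review is weaker
than expert review.

## Why (the (M)/(M⁺) edge, res-L1-s46-pv-7 p471737 / res-L1-type-o1 v4 2026-08-27T00:53Z)

Every rung-(ii) reduction landed so far (`…ThreefoldsReduction/Components/Singular/Padded/PaddedNabla/Monotone`) is phrased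
through the (M) accessors `Resume.invStr`, `Resume.m` (strings over `𝒴(0), …, 𝒴(t−1)`). Under (M) the one-step shape
`DecreaseAlongSteps` inherits the `t = 0` EDGE (Eq. (127) against the empty string is unsatisfiable), so for notion instances
with `t = 0` résumés in the regime the hypothesis `DecreaseII` cannot hold and the rung is vacuous there; the reading sibling
(M⁺) (`DecreaseAlongStepsSucc`, strings over `𝒴(0), …, 𝒴(t)`) has no such edge. Rather than duplicating six proof modules,
this module abstracts WHAT THE REDUCTIONS USE of a reading: a STRING READING `σ` = (a string `σ.str R ξ` at every point of
every résumé, a length `σ.len R`, and `length (σ.str R ξ) = σ.len R`), and restates the five hypothesis shapes for an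
arbitrary `σ` — `DecreaseShape` (Eq. (127) off `∇′` over the centre), `PrefixShape` (Eq. (128) on `∇′` read as «the new
string is the old one cut to the new length», which is what (3) + «`m′ ≤ m`» give under either reading), `StopsShape`
(`m′ ≤ m`), `TopSingShape` (terminal plat = top `Inv`-stratum of `Sing(E)`), `MonotoneShape` (off the centre the string does
not go up). Instances: `readingM` (M) and `readingMSucc` (M⁺). The companion module proves the whole-∇ and the
component-wise ∇-centred reductions ONCE for every `σ` (regime inside `dimLE d` for the latter), and
`MarkedTransferCampaignW46ThreefoldsSucc` instantiates them at (M⁺) for rung (ii).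

References: shared module v4 (p479675) + anchors v3 (p480427); Threefolds.lean v4 (p481395); H. Hironaka, ms. 2017-03-23,
Th. 16.6 p.84 l.10–28, §16.3 p.87 l.14–24, Eq. (34) p.24 — scope only, under adjudication, not cited as fact. [Hironaka2017]
-/

noncomputable section

set_option linter.dupNamespace false -- mandated namespace of this single-conjunct summit

open CategoryTheory AlgebraicGeometry TopologicalSpace

namespace Summit.ResolutionOfSingularities.ResolutionOfSingularities.Theorems

namespace CampaignW46

open Literature.AlgebraicGeometry.Resolution
open Literature.AlgebraicGeometry.Hironaka2017.S02Preliminaries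
open Literature.AlgebraicGeometry.Hironaka2017.Datum
open Literature.AlgebraicGeometry.Hironaka2017.S15ARSchemes
open Literature.AlgebraicGeometry.Hironaka2017.S16Proof
open Literature.AlgebraicGeometry.Hironaka2017.InvStringOrder

universe u

variable {n : ℕ}

/-- [OURS · L1 W4.6] A STRING READING of the résumés of the notion instance `N`: to every résumé `R` of an ideal exponent
on an ambient datum it assigns the `Inv`-STRING `σ.str R ξ` at each point `ξ` (the string compared in Eq. (127)/(128),
p.84 l.10–28) and its LENGTH `σ.len R` («the actual number `m` of stops», p.84 l.17), with `length (σ.str R ξ) = σ.len R`.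
The two readings of the shared module are the instances `readingM` (design point (M): `Resume.invStr`, `Resume.m = t`) and
`readingMSucc` ((M⁺): `Resume.invStrSucc`, `Resume.mSucc = t + 1`). Bookkeeping abstraction; NOT a statement of the
manuscript. [folklore] -/
structure StringReading (p : ℕ) [Fact p.Prime] (K : Type u) [Field K] [CharP K p] (N : Notions.{u} n) :
    Type (u + 1) where
  /-- the `Inv`-string of the résumé `R` at the point `ξ` -/
  str : ∀ {A : AmbientDatum p K} {E : IdealExponent A.Z}, Resume N A E → A.Z → List (EdgeInv n)
  /-- the number of stops read (the common length of the strings of `R`) -/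
  len : ∀ {A : AmbientDatum p K} {E : IdealExponent A.Z}, Resume N A E → ℕ
  /-- every string of `R` has length `len R` -/
  length_str : ∀ {A : AmbientDatum p K} {E : IdealExponent A.Z} (R : Resume N A E) (ξ : A.Z),
    (str R ξ).length = len R

variable {p : ℕ} [Fact p.Prime] {K : Type u} [Field K] [CharP K p]

/-- [OURS · L1 W4.6] THE READING (M) of the shared module as a string reading: `str R ξ = R.invStr ξ`
(`(Inv_ξ(𝒴(0)), …, Inv_ξ(𝒴(t−1)))`), `len R = R.m = t` (design point (M)). NOT a statement of the manuscript. [folklore] -/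
def readingM (N : Notions.{u} n) : StringReading p K N where
  str R ξ := R.invStr ξ
  len R := R.m
  length_str R ξ := R.length_invStr ξ

/-- [OURS · L1 W4.6] THE READING (M⁺) of the shared module (v4) as a string reading: `str R ξ = R.invStrSucc ξ`
(`(Inv_ξ(𝒴(0)), …, Inv_ξ(𝒴(t)))`, terminal stage included), `len R = R.mSucc = t + 1`. NOT a statement of the manuscript.
[folklore] -/
def readingMSucc (N : Notions.{u} n) : StringReading p K N where
  str R ξ := R.invStrSucc ξ
  len R := R.mSucc
  length_str R ξ := by rw [Resume.length_invStrSucc, Resume.mSucc_eq]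

namespace StringReading

variable {N : Notions.{u} n}

/-- [OURS · L1 W4.6] replaces the role of Th. 16.6 (2) / Eq. (127) p.84 l.10–20 for the string reading `σ`, RESTRICTED to
the regime `Rg`, as a HYPOTHESIS SHAPE; NOT a statement of the manuscript. For every state `(A, E, R)` in `Rg` read by `Rd`,
every step `s` admitted by the typed centre rule, every résumé `R′` of the transform read by `Rd`, and every CLOSED point `ξ′`
over the centre (`π ξ′ ∈ D`) NOT on the strict transform `∇′` of `∇(E)` (i.e. `ξ′ ∉ D′ = ∇′ ∩ π⁻¹(D)`): the string of `R′` at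
`ξ′` is strictly below the string of `R` at `π ξ′` in the 0-padded order (`InvString.LexLT`). At `σ = readingM` it follows
from `DecreaseAlongSteps`, at `σ = readingMSucc` from `DecreaseAlongStepsSucc` (companion module). Never asserted. [folklore] -/
def DecreaseShape (σ : StringReading p K N) (Rd : Reading p K N) (Rg : Regime p K) : Prop :=
  ∀ (A : AmbientDatum p K) (E : IdealExponent A.Z) (R : Resume N A E), Rg A E → Rd A E R →
    ∀ (A' : AmbientDatum p K) (s : Step R A') (R' : Resume N A' s.E'), Rd A' s.E' R' →
      ∀ ξ' : A'.Z, ξ' ∈ Literature.AlgebraicGeometry.Hironaka2017.S02Preliminaries.closedPoints A'.Z → s.π ξ' ∈ (s.D : Set A.Z) →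
        ξ' ∉ strictTransformSet s.π (s.D : Set A.Z) (R.nabla : Set A.Z) →
          InvString.LexLT (σ.str R' ξ') (σ.str R (s.π ξ'))

/-- [OURS · L1 W4.6] replaces the role of Th. 16.6 (3) / Eq. (128) p.84 l.21–28 together with «`m′ ≤ m`» l.17–18 for the
string reading `σ`, RESTRICTED to `Rg`, as a HYPOTHESIS SHAPE in PREFIX FORM; NOT a statement of the manuscript. For every
state in `Rg` read by `Rd`, every admitted step, every résumé `R′` of the transform read by `Rd`, and every CLOSED point `ξ′` of
the strict transform `∇′`: the string of `R′` at `ξ′` is the string of `R` at `π ξ′` cut to the length of `R′` (Eq. (128)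
written with both strings at length `m`, read back at length `m′ ≤ m`). At `readingM` it follows from `EqualityAlongSteps ∧
StopsMonotone`, at `readingMSucc` from their (M⁺) twins (companion module). Never asserted. [folklore] -/
def PrefixShape (σ : StringReading p K N) (Rd : Reading p K N) (Rg : Regime p K) : Prop :=
  ∀ (A : AmbientDatum p K) (E : IdealExponent A.Z) (R : Resume N A E), Rg A E → Rd A E R →
    ∀ (A' : AmbientDatum p K) (s : Step R A') (R' : Resume N A' s.E'), Rd A' s.E' R' →
      ∀ ξ' : A'.Z, ξ' ∈ Literature.AlgebraicGeometry.Hironaka2017.S02Preliminaries.closedPoints A'.Z →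
        ξ' ∈ strictTransformSet s.π (s.D : Set A.Z) (R.nabla : Set A.Z) →
          σ.str R' ξ' = (σ.str R (s.π ξ')).take (σ.len R')

/-- [OURS · L1 W4.6] replaces the role of «`m′ ≤ m`» (p.84 l.17–18) read globally for the string reading `σ`, RESTRICTED to
`Rg`, as a HYPOTHESIS SHAPE; NOT a statement of the manuscript: along every admitted step from a state in `Rg` (read by
`Rd`, as is the résumé of the transform) the length does not increase, `σ.len R′ ≤ σ.len R`. (The same condition under (M)
and (M⁺): `t′ ≤ t`.) Never asserted. [folklore] -/
def StopsShape (σ : StringReading p K N) (Rd : Reading p K N) (Rg : Regime p K) : Prop :=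
  ∀ (A : AmbientDatum p K) (E : IdealExponent A.Z) (R : Resume N A E), Rg A E → Rd A E R →
    ∀ (A' : AmbientDatum p K) (s : Step R A') (R' : Resume N A' s.E'), Rd A' s.E' R' → σ.len R' ≤ σ.len R

/-- [OURS · L1 W4.6] replaces the role of «the terminal plat `∇(E)` is the stratum of worst points of `Sing(E)`»
(Def. 15.11/15.12 p.80 l.29 – p.81 l.4; §16.3 p.87 l.14–24) for the string reading `σ`, RESTRICTED to `Rg`, as a
HYPOTHESIS SHAPE; NOT a statement of the manuscript. For every state `(A, E)` in `Rg` with résumé `R` read by `Rd` there is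
a CLOSED `η ∈ ∇(E)` such that (T1) every closed point of `∇(E)` has the same `σ`-string as `η` and (T2-Sing) every closed
point of `Sing(E)` off `∇(E)` has a strictly smaller one. (`readingM`: `NablaTopSing`.) Never asserted. [folklore] -/
def TopSingShape (σ : StringReading p K N) (Rd : Reading p K N) (Rg : Regime p K) : Prop :=
  ∀ (A : AmbientDatum p K) (E : IdealExponent A.Z) (R : Resume N A E), Rg A E → Rd A E R →
    ∃ η : A.Z, η ∈ (R.nabla : Set A.Z) ∧ η ∈ Literature.AlgebraicGeometry.Hironaka2017.S02Preliminaries.closedPoints A.Z ∧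
      (∀ ξ : A.Z, ξ ∈ Literature.AlgebraicGeometry.Hironaka2017.S02Preliminaries.closedPoints A.Z →
        ξ ∈ (R.nabla : Set A.Z) → σ.str R ξ = σ.str R η) ∧
      (∀ ξ : A.Z, ξ ∈ Literature.AlgebraicGeometry.Hironaka2017.S02Preliminaries.closedPoints A.Z →
        ξ ∈ E.sing → ξ ∉ (R.nabla : Set A.Z) → InvString.LexLT (σ.str R ξ) (σ.str R η))

/-- [OURS · L1 W4.6] replaces the role of «a blow-up changes nothing away from its centre — in particular nothing gets
WORSE there» (Eq. (34) p.24 locality of `Inv_ξ`; «`m′ ≤ m` … adding (0) repeatedly» p.84 l.17–20; «deletions of those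
with Sing emptied» §16.3 p.87 l.16–17) for the string reading `σ`, MONOTONE FORM, RESTRICTED to `Rg`, as a HYPOTHESIS
SHAPE; NOT a statement of the manuscript: at every CLOSED `ξ′` with `π ξ′ ∉ D` the `σ`-string of `R′` at `ξ′` is NOT
strictly above the `σ`-string of `R` at `π ξ′`. (`readingM`: `OffCentreMonotone`.) Never asserted. [folklore] -/
def MonotoneShape (σ : StringReading p K N) (Rd : Reading p K N) (Rg : Regime p K) : Prop :=
  ∀ (A : AmbientDatum p K) (E : IdealExponent A.Z) (R : Resume N A E), Rg A E → Rd A E R →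
    ∀ (A' : AmbientDatum p K) (s : Step R A') (R' : Resume N A' s.E'), Rd A' s.E' R' →
      ∀ ξ' : A'.Z, ξ' ∈ Literature.AlgebraicGeometry.Hironaka2017.S02Preliminaries.closedPoints A'.Z → s.π ξ' ∉ (s.D : Set A.Z) →
        ¬ InvString.LexLT (σ.str R (s.π ξ')) (σ.str R' ξ')

/-- [OURS · L1 W4.6] the monotone off-centre shape ASKED ONLY WHERE `Inv_ξ` IS DEFINED (appended 2026-08-27, append-only)
— replaces the same role as `MonotoneShape` (Eq. (34) p.24 defines `Inv_ξ` for SINGULAR points; §16.3 p.87 l.16–23), as a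
HYPOTHESIS SHAPE for the string reading `σ` restricted to `Rg`; NOT a statement of the manuscript: at every CLOSED `ξ′` off
the centre (`π ξ′ ∉ D`) whose image is a SINGULAR point of `E` (`π ξ′ ∈ Sing(E)`; equivalently `ξ′ ∈ Sing(E′)`, the blow-up
being an isomorphism there), the `σ`-string of `R′` at `ξ′` is not strictly above the `σ`-string of `R` at `π ξ′`. Weaker
than `MonotoneShape` (which also consults the strings at non-singular points — the scope issue lane B recorded for `NablaTop`,
answered there by `NablaTopSing`); the companion module `MarkedTransferCampaignW46StringReadingReductionSing` shows it is all
the reductions use. Never asserted. [folklore] -/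
def MonotoneSingShape (σ : StringReading p K N) (Rd : Reading p K N) (Rg : Regime p K) : Prop :=
  ∀ (A : AmbientDatum p K) (E : IdealExponent A.Z) (R : Resume N A E), Rg A E → Rd A E R →
    ∀ (A' : AmbientDatum p K) (s : Step R A') (R' : Resume N A' s.E'), Rd A' s.E' R' →
      ∀ ξ' : A'.Z, ξ' ∈ Literature.AlgebraicGeometry.Hironaka2017.S02Preliminaries.closedPoints A'.Z → s.π ξ' ∈ E.sing →
        s.π ξ' ∉ (s.D : Set A.Z) → ¬ InvString.LexLT (σ.str R (s.π ξ')) (σ.str R' ξ')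

end StringReading

/-! ## Unfoldings of the two instances -/

section Unfold

variable {N : Notions.{u} n} {A : AmbientDatum p K} {E : IdealExponent A.Z} (R : Resume N A E) (ξ : A.Z)

/-- Unfolding: the (M) reading's string is `Resume.invStr`. [folklore] -/
theorem readingM_str : (readingM (p := p) (K := K) N).str R ξ = R.invStr ξ := rfl

/-- Unfolding: the (M) reading's length is `Resume.m`. [folklore] -/
theorem readingM_len : (readingM (p := p) (K := K) N).len R = R.m := rfl

/-- Unfolding: the (M⁺) reading's string is `Resume.invStrSucc`. [folklore] -/
theorem readingMSucc_str : (readingMSucc (p := p) (K := K) N).str R ξ = R.invStrSucc ξ := rfl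

/-- Unfolding: the (M⁺) reading's length is `Resume.mSucc`. [folklore] -/
theorem readingMSucc_len : (readingMSucc (p := p) (K := K) N).len R = R.mSucc := rfl

end Unfold

end CampaignW46

end Summit.ResolutionOfSingularities.ResolutionOfSingularities.Theorems

end
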